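import Summits.BirchSwinnertonDyer.BirchSwinnertonDyer.Theorems.RamifiedHeegnerPairLeafPartnerOrdersBaseChangeOperators
import Mathlib.NumberTheory.Padics.PadicIntegers
import Mathlib.RingTheory.Flat.TorsionFree
import HarnessLib

/-!
# Route `RamifiedHeegnerPair`, crux U₁ `LeafRankOneUpperAtThree` (stmt-BirchSwinnertonDyer-26022), line `partnerdescent` —
# partner kernel, base change (α) part 5: LATTICES over `ℤ₃` — the spanning sets of `B̂` and `Ŷ`, the Hecke ring in `ℤ₃[Ĝ]`, multiplicity one read over `ℤ₃`

HONEST FRAMING. Theorems only; helper file (`--supports stmt-BirchSwinnertonDyer-26022 --as helper`); elementary linear algebra over Mathlib at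
`S = ℤ₃ = ℤ_[3]`, continuing ‹…BaseChangeCoordinates› / ‹…BaseChangeOperators›; no number theory, no named fact, no `sorry`; nothing booked;
BSD is proved for no curve. Lead prover bsd-line-rhp-p2 g64, 2026-08-31.

WHAT. With `M = B̂ = {v ∈ ℤ₃^ι : Σ v = 0}` (given by `hM`), `ρ : ℤ[G] → End M` (given by `hρ : (ρ C m)^ = Ĉ m`) and `v ↦ v̂` the coordinatewise
cast: `intCast_vec_smul/sub` (casts of integral vectors), `map_intCast_mulVec'` (rectangular `(C v)^ = Ĉ v̂`), `mem_span_intCast_degreeZero`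
(`M` is the `ℤ₃`-span of the `b̂`, `b ∈ B`, INSIDE `M`), `mem_span_intCast_of_map_mulVec_eq_zero` (`{m ∈ M : Ĉ_Y m = 0}` is the `ℤ₃`-span of the
`ŷ`, `y ∈ Y = ker C_Y`, inside `M`), `ringHom_mem_adjoin_range` (`ρ(ℤ[G]) ⊆ ℤ₃[ρ(G)]`), `map_mulVec_mem_ker_of_forall` / `eq_smul_of_forall_mulVec_eq_smul`
/ `map_mulVec_mem_ker_of_forall_mem` (a `Y`-preserving, resp. `Y`-scaling, resp. `B → Y` integer matrix does the same to `Ŷ` over `ℤ₃`), and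
`exists_sub_mem_of_integral_cosocle`: the INTEGRAL multiplicity-one hypothesis (C3′) «`x − C x₀ ∈ 3B + Σ_X (X − λ_X)B`, `C ∈ ℤ[G]`» gives the
`ℤ₃`-form «`x − c x̂₀ ∈ 𝔪_{ℤ₃}·M + Σ_f (f − λ_f)·M`, `c ∈ ℤ₃[ρ(G)]`» consumed by `dvd_of_generatorsRun` (p812855).
[cite: Matsumura1987, Thm. 7.4 (i), Thm. 7.6] [cite: BourbakiAlgebraI1989, Ch. II §1 no. 11]
-/

set_option linter.dupNamespace false
set_option autoImplicit false

noncomputable section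

open scoped Pointwise

namespace Summit.BirchSwinnertonDyer.BirchSwinnertonDyer.Theorems.LeafPartnerOrders

open Matrix IsLocalRing

section Casts

variable {S : Type*} [CommRing S] {ι : Type*} [Fintype ι]

omit [Fintype ι] in
/-- `(n·v)^ = n·v̂`. [folklore] -/
theorem intCast_vec_smul (n : ℤ) (v : ι → ℤ) : (fun c ↦ (((n • v) c : ℤ) : S)) = (n : S) • fun c ↦ ((v c : ℤ) : S) := by
  funext c
  change (((n • v) c : ℤ) : S) = (n : S) * (v c : S)
  rw [Pi.smul_apply, smul_eq_mul, Int.cast_mul]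

omit [Fintype ι] in
/-- `(v − v')^ = v̂ − v̂'`. [folklore] -/
theorem intCast_vec_sub (v v' : ι → ℤ) : (fun c ↦ (((v - v') c : ℤ) : S)) = (fun c ↦ ((v c : ℤ) : S)) - fun c ↦ ((v' c : ℤ) : S) := by
  funext c
  change (((v - v') c : ℤ) : S) = (v c : S) - (v' c : S)
  rw [Pi.sub_apply, Int.cast_sub]

/-- `(C v)^ = Ĉ v̂` for a rectangular integer matrix. [folklore] -/
theorem map_intCast_mulVec' {ρ : Type*} (C : Matrix ρ ι ℤ) (v : ι → ℤ) :
    (fun c ↦ (((C *ᵥ v) c : ℤ) : S)) = C.map (Int.castRingHom S) *ᵥ fun c ↦ ((v c : ℤ) : S) := by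
  funext c
  have h := RingHom.map_mulVec (Int.castRingHom S) C v c
  simpa [Function.comp_def] using h

variable {V : Type*} [AddCommGroup V] [Module S V]

/-- Span membership descends along the inclusion of a submodule. [folklore] -/
theorem mem_span_of_coe_mem_span_image (N : Submodule S V) (T : Set N) (v : N)
    (h : (v : V) ∈ Submodule.span S (N.subtype '' T)) : v ∈ Submodule.span S T := by
  rw [← Submodule.map_span] at h
  obtain ⟨n, hn, hnv⟩ := Submodule.mem_map.mp h
  have : n = v := Subtype.ext (by simpa using hnv)
  exact this ▸ hn

end Casts

section Lattices

variable {ι : Type*} [Fintype ι] [DecidableEq ι]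

/-- **`M` is spanned, inside `M`, by the integral degree-zero vectors.** [cite: BourbakiAlgebraI1989, Ch. II §1 no. 11] -/
theorem mem_span_intCast_degreeZero (M : Submodule ℤ_[3] (ι → ℤ_[3])) (hM : ∀ v : ι → ℤ_[3], v ∈ M ↔ ∑ c, v c = 0) (c₀ : ι) (m : M) :
    m ∈ Submodule.span ℤ_[3] {m : M | ∃ b : ι → ℤ, ∑ c, b c = 0 ∧ (m : ι → ℤ_[3]) = fun c ↦ ((b c : ℤ) : ℤ_[3])} := by
  apply mem_span_of_coe_mem_span_image
  have h1 := mem_span_image_intCast_of_sum_eq_zero (S := ℤ_[3]) c₀ (m : ι → ℤ_[3]) ((hM _).mp m.2)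
  refine Submodule.span_mono ?_ h1
  rintro _ ⟨b, hb, rfl⟩
  have hbM : (fun c ↦ ((b c : ℤ) : ℤ_[3])) ∈ M := by
    rw [hM]
    have : ((∑ c, b c : ℤ) : ℤ_[3]) = 0 := by rw [show ∑ c, b c = 0 from hb, Int.cast_zero]
    rwa [Int.cast_sum] at this
  exact ⟨⟨_, hbM⟩, ⟨b, hb, rfl⟩, rfl⟩

/-- **`Ŷ = {m ∈ M : Ĉ_Y m = 0}` is spanned, inside `M`, by the `ŷ`, `y ∈ Y = ker C_Y`** (flatness, p812051). [cite: Matsumura1987, Thm. 7.6] -/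
theorem mem_span_intCast_of_map_mulVec_eq_zero (M : Submodule ℤ_[3] (ι → ℤ_[3])) {r : ℕ} (CY : Matrix (Fin r) ι ℤ)
    (Y : Submodule ℤ (ι → ℤ)) (hCY : ∀ v : ι → ℤ, v ∈ Y ↔ CY *ᵥ v = 0)
    (hYM : ∀ y ∈ Y, (fun c ↦ ((y c : ℤ) : ℤ_[3])) ∈ M) (m : M) (hm : CY.map (Int.castRingHom ℤ_[3]) *ᵥ (m : ι → ℤ_[3]) = 0) :
    m ∈ Submodule.span ℤ_[3] {m : M | ∃ y ∈ Y, (m : ι → ℤ_[3]) = fun c ↦ ((y c : ℤ) : ℤ_[3])} := by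
  apply mem_span_of_coe_mem_span_image
  have h1 := mem_span_image_of_mem_ker (S := ℤ_[3]) CY Y hCY (m : ι → ℤ_[3]) hm
  refine Submodule.span_mono ?_ h1
  rintro _ ⟨y, hy, rfl⟩
  exact ⟨⟨_, hYM y hy⟩, ⟨y, hy, rfl⟩, rfl⟩

/-- **`ℤ[G]` read over `ℤ₃` lies in `ℤ₃[s]`**: if every generator `X ∈ G` is the action of some `f ∈ s ⊆ End M`, then every `C ∈ ℤ[G]`
is the action of some `c ∈ ℤ₃[s]`. [folklore] -/
theorem exists_mem_adjoin_acting (M : Submodule ℤ_[3] (ι → ℤ_[3])) (G : Set (Matrix ι ι ℤ)) (s : Set (Module.End ℤ_[3] M))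
    (hGs : ∀ X ∈ G, ∃ f ∈ s, ∀ m : M, ((f m : M) : ι → ℤ_[3]) = X.map (Int.castRingHom ℤ_[3]) *ᵥ (m : ι → ℤ_[3]))
    {C : Matrix ι ι ℤ} (hC : C ∈ Algebra.adjoin ℤ G) :
    ∃ c ∈ Algebra.adjoin ℤ_[3] s, ∀ m : M, ((c m : M) : ι → ℤ_[3]) = C.map (Int.castRingHom ℤ_[3]) *ᵥ (m : ι → ℤ_[3]) := by
  induction hC using Algebra.adjoin_induction with
  | mem X hX =>
      obtain ⟨f, hf, hfX⟩ := hGs X hX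
      exact ⟨f, Algebra.subset_adjoin hf, hfX⟩
  | algebraMap n =>
      refine ⟨(n : ℤ_[3]) • (1 : Module.End ℤ_[3] M), Subalgebra.smul_mem _ (Subalgebra.one_mem _) _, fun m ↦ ?_⟩
      have hmap : (algebraMap ℤ (Matrix ι ι ℤ) n).map (Int.castRingHom ℤ_[3]) = (n : ℤ_[3]) • (1 : Matrix ι ι ℤ_[3]) := by
        ext i j
        rw [Algebra.algebraMap_eq_smul_one]
        simp only [Matrix.map_apply, Matrix.smul_apply, Matrix.one_apply, smul_eq_mul, mul_ite, mul_one, mul_zero]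
        split_ifs <;> simp
      rw [hmap, smul_mulVec, one_mulVec, LinearMap.smul_apply, Module.End.one_apply, Submodule.coe_smul]
  | add C C' _ _ ih ih' =>
      obtain ⟨c, hc, h⟩ := ih
      obtain ⟨c', hc', h'⟩ := ih'
      refine ⟨c + c', Subalgebra.add_mem _ hc hc', fun m ↦ ?_⟩
      rw [LinearMap.add_apply, Submodule.coe_add, h, h', Matrix.map_add _ (map_add _), add_mulVec]
  | mul C C' _ _ ih ih' =>
      obtain ⟨c, hc, h⟩ := ih
      obtain ⟨c', hc', h'⟩ := ih'
      refine ⟨c * c', Subalgebra.mul_mem _ hc hc', fun m ↦ ?_⟩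
      rw [Module.End.mul_apply, h, h', mulVec_mulVec, Matrix.map_mul]

omit [DecidableEq ι] in
/-- **An integer matrix with `C_Y·(X y) = 0` on a set `T` kills, after `Ĉ_Y`, the `ℤ₃`-span of `T̂`** (`f ∈ End M` acting as `X̂`).
[cite: Matsumura1987, Thm. 7.6] -/
theorem map_mulVec_eq_zero_of_forall (M : Submodule ℤ_[3] (ι → ℤ_[3])) {r : ℕ} (CY : Matrix (Fin r) ι ℤ)
    (T : Set (ι → ℤ)) (f : Module.End ℤ_[3] M) (X : Matrix ι ι ℤ)
    (hf : ∀ m : M, ((f m : M) : ι → ℤ_[3]) = X.map (Int.castRingHom ℤ_[3]) *ᵥ (m : ι → ℤ_[3]))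
    (hX : ∀ y ∈ T, CY *ᵥ (X *ᵥ y) = 0) (m : M)
    (hm : m ∈ Submodule.span ℤ_[3] {m : M | ∃ y ∈ T, (m : ι → ℤ_[3]) = fun c ↦ ((y c : ℤ) : ℤ_[3])}) :
    CY.map (Int.castRingHom ℤ_[3]) *ᵥ ((f m : M) : ι → ℤ_[3]) = 0 := by
  induction hm using Submodule.span_induction with
  | mem m hm =>
      obtain ⟨y, hy, hmy⟩ := hm
      rw [hf, hmy, ← map_intCast_mulVec', ← map_intCast_mulVec', hX y hy]
      funext c
      simp
  | zero => rw [map_zero, Submodule.coe_zero, mulVec_zero]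
  | add m m' _ _ ih ih' => rw [map_add, Submodule.coe_add, mulVec_add, ih, ih', add_zero]
  | smul a m _ ih => rw [map_smul, Submodule.coe_smul, mulVec_smul, ih, smul_zero]

omit [DecidableEq ι] in
/-- **An integer matrix acting as the scalar `N₀` on `T` acts as `N₀` on the `ℤ₃`-span of `T̂`.** [cite: Matsumura1987, Thm. 7.6] -/
theorem eq_smul_of_forall_mulVec_eq_smul (M : Submodule ℤ_[3] (ι → ℤ_[3])) (T : Set (ι → ℤ)) (f : Module.End ℤ_[3] M)
    (X : Matrix ι ι ℤ) (hf : ∀ m : M, ((f m : M) : ι → ℤ_[3]) = X.map (Int.castRingHom ℤ_[3]) *ᵥ (m : ι → ℤ_[3]))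
    (N₀ : ℤ) (hX : ∀ y ∈ T, X *ᵥ y = N₀ • y) (m : M)
    (hm : m ∈ Submodule.span ℤ_[3] {m : M | ∃ y ∈ T, (m : ι → ℤ_[3]) = fun c ↦ ((y c : ℤ) : ℤ_[3])}) :
    f m = (N₀ : ℤ_[3]) • m := by
  induction hm using Submodule.span_induction with
  | mem m hm =>
      obtain ⟨y, hy, hmy⟩ := hm
      apply Subtype.ext
      rw [hf, Submodule.coe_smul, hmy, ← map_intCast_mulVec', hX y hy, intCast_vec_smul]
  | zero => rw [map_zero, smul_zero]
  | add m m' _ _ ih ih' => rw [map_add, ih, ih', smul_add]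
  | smul a m _ ih => rw [map_smul, ih, smul_comm]

omit [DecidableEq ι] in
/-- **An integer matrix mapping `T` into the line `ℤ g` maps the `ℤ₃`-span of `T̂` into `ℤ₃ ĝ`.** [cite: Matsumura1987, Thm. 7.6] -/
theorem exists_eq_smul_of_forall (M : Submodule ℤ_[3] (ι → ℤ_[3])) (T : Set (ι → ℤ)) (f : Module.End ℤ_[3] M)
    (X : Matrix ι ι ℤ) (hf : ∀ m : M, ((f m : M) : ι → ℤ_[3]) = X.map (Int.castRingHom ℤ_[3]) *ᵥ (m : ι → ℤ_[3]))
    (g : ι → ℤ) (gM : M) (hgM : (gM : ι → ℤ_[3]) = fun c ↦ ((g c : ℤ) : ℤ_[3]))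
    (hX : ∀ y ∈ T, ∃ n : ℤ, X *ᵥ y = n • g) (m : M)
    (hm : m ∈ Submodule.span ℤ_[3] {m : M | ∃ y ∈ T, (m : ι → ℤ_[3]) = fun c ↦ ((y c : ℤ) : ℤ_[3])}) :
    ∃ a : ℤ_[3], f m = a • gM := by
  induction hm using Submodule.span_induction with
  | mem m hm =>
      obtain ⟨y, hy, hmy⟩ := hm
      obtain ⟨n, hn⟩ := hX y hy
      refine ⟨(n : ℤ_[3]), Subtype.ext ?_⟩
      rw [hf, Submodule.coe_smul, hmy, hgM, ← map_intCast_mulVec', hn, intCast_vec_smul]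
  | zero => exact ⟨0, by rw [map_zero, zero_smul]⟩
  | add m m' _ _ ih ih' =>
      obtain ⟨a, ha⟩ := ih
      obtain ⟨a', ha'⟩ := ih'
      exact ⟨a + a', by rw [map_add, ha, ha', add_smul]⟩
  | smul c m _ ih =>
      obtain ⟨a, ha⟩ := ih
      exact ⟨c * a, by rw [map_smul, ha, smul_smul]⟩

/-- **`3B + Σ_X (X − λ_X)B` read over `ℤ₃` lies in `𝔪_{ℤ₃}·M + Σ_f (f − λ_f)·M`** (each generator `X` being the action of some `f ∈ s`
with `λ_f = λ_X`). [cite: Matsumura1987, Thm. 7.4 (i)] -/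
theorem intCast_mem_cosocle (M : Submodule ℤ_[3] (ι → ℤ_[3])) (hM : ∀ v : ι → ℤ_[3], v ∈ M ↔ ∑ c, v c = 0)
    (B : Submodule ℤ (ι → ℤ)) (hB : ∀ v : ι → ℤ, v ∈ B ↔ ∑ c, v c = 0)
    (G : Set (Matrix ι ι ℤ)) (hGdeg : ∀ X ∈ G, ∀ v : ι → ℤ, ∑ c, v c = 0 → ∑ c, (X *ᵥ v) c = 0)
    (s : Set (Module.End ℤ_[3] M)) (lam : Matrix ι ι ℤ → ℤ) (lam' : Module.End ℤ_[3] M → ℤ_[3])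
    (hGs : ∀ X ∈ G, ∃ f ∈ s, lam' f = (lam X : ℤ_[3]) ∧
      ∀ m : M, ((f m : M) : ι → ℤ_[3]) = X.map (Int.castRingHom ℤ_[3]) *ᵥ (m : ι → ℤ_[3]))
    (z : ι → ℤ) (hz : z ∈ (3 : ℤ) • B ⊔ ⨆ X ∈ G, B.map (Matrix.mulVecLin (X - lam X • (1 : Matrix ι ι ℤ)))) :
    ∃ hzM : (fun c ↦ ((z c : ℤ) : ℤ_[3])) ∈ M,
      (⟨_, hzM⟩ : M) ∈ maximalIdeal ℤ_[3] • (⊤ : Submodule ℤ_[3] M) ⊔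
        ⨆ f ∈ s, LinearMap.range (f - lam' f • (1 : Module.End ℤ_[3] M)) := by
  classical
  have hcastM : ∀ v : ι → ℤ, ∑ c, v c = 0 → (fun c ↦ ((v c : ℤ) : ℤ_[3])) ∈ M := fun v hv ↦ by
    rw [hM]
    have : ((∑ c, v c : ℤ) : ℤ_[3]) = 0 := by rw [hv, Int.cast_zero]
    rwa [Int.cast_sum] at this
  -- the integral vectors of `B`, `ℤ`-linearly, and the submodule of good `z`
  let castB : B →ₗ[ℤ] M :=
    { toFun := fun b ↦ ⟨fun c ↦ (((b : ι → ℤ) c : ℤ) : ℤ_[3]), hcastM b ((hB b).mp b.2)⟩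
      map_add' := fun b b' ↦ Subtype.ext (funext fun c ↦ by
        change ((((b : ι → ℤ) + (b' : ι → ℤ)) c : ℤ) : ℤ_[3]) = (((b : ι → ℤ) c : ℤ) : ℤ_[3]) + (((b' : ι → ℤ) c : ℤ) : ℤ_[3])
        rw [Pi.add_apply, Int.cast_add])
      map_smul' := fun n b ↦ Subtype.ext (funext fun c ↦ by
        change (((n • (b : ι → ℤ)) c : ℤ) : ℤ_[3]) = (n • fun d ↦ (((b : ι → ℤ) d : ℤ) : ℤ_[3])) c
        rw [Pi.smul_apply, Pi.smul_apply, smul_eq_mul, Int.cast_mul, zsmul_eq_mul]) }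
  let N' : Submodule ℤ_[3] M := maximalIdeal ℤ_[3] • (⊤ : Submodule ℤ_[3] M) ⊔
    ⨆ f ∈ s, LinearMap.range (f - lam' f • (1 : Module.End ℤ_[3] M))
  let Q : Submodule ℤ (ι → ℤ) := Submodule.map B.subtype ((N'.restrictScalars ℤ).comap castB)
  have hQmem : ∀ v, v ∈ Q → ∃ hv : v ∈ B, castB ⟨v, hv⟩ ∈ N' := by
    rintro _ ⟨b, hb, rfl⟩
    exact ⟨b.2, hb⟩
  have h3mem : (3 : ℤ_[3]) ∈ maximalIdeal ℤ_[3] := by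
    rw [PadicInt.maximalIdeal_eq_span_p]
    exact_mod_cast Ideal.mem_span_singleton_self (3 : ℤ_[3])
  have hle : (3 : ℤ) • B ⊔ ⨆ X ∈ G, B.map (Matrix.mulVecLin (X - lam X • (1 : Matrix ι ι ℤ))) ≤ Q := by
    refine sup_le ?_ (iSup₂_le fun X hX ↦ ?_)
    · intro v hv
      obtain ⟨b, hb, rfl⟩ := (Submodule.mem_smul_pointwise_iff_exists v (3 : ℤ) B).mp hv
      refine ⟨⟨(3 : ℤ) • b, B.smul_mem _ hb⟩, ?_, rfl⟩
      change castB ⟨(3 : ℤ) • b, B.smul_mem _ hb⟩ ∈ N'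
      have : castB ⟨(3 : ℤ) • b, B.smul_mem _ hb⟩ = (3 : ℤ_[3]) • castB ⟨b, hb⟩ := by
        apply Subtype.ext
        change (fun c ↦ ((((3 : ℤ) • b) c : ℤ) : ℤ_[3])) = (3 : ℤ_[3]) • fun c ↦ ((b c : ℤ) : ℤ_[3])
        rw [intCast_vec_smul]
        norm_num
      rw [this]
      exact Submodule.mem_sup_left (Submodule.smul_mem_smul h3mem Submodule.mem_top)
    · rintro _ ⟨b, hb, rfl⟩
      obtain ⟨f, hf, hlamf, hfX⟩ := hGs X hX
      have hXb : (X - lam X • (1 : Matrix ι ι ℤ)) *ᵥ b = X *ᵥ b - lam X • b := by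
        rw [sub_mulVec, smul_mulVec, one_mulVec]
      have hbz : Matrix.mulVecLin (X - lam X • (1 : Matrix ι ι ℤ)) b ∈ B := by
        rw [Matrix.mulVecLin_apply, hXb, hB]
        simp only [Pi.sub_apply, Pi.smul_apply, smul_eq_mul, Finset.sum_sub_distrib, ← Finset.mul_sum, (hB b).mp hb,
          hGdeg X hX b ((hB b).mp hb), mul_zero, sub_zero]
      refine ⟨⟨_, hbz⟩, ?_, rfl⟩
      change castB ⟨_, hbz⟩ ∈ N'
      refine Submodule.mem_sup_right (Submodule.mem_iSup_of_mem f (Submodule.mem_iSup_of_mem hf ⟨castB ⟨b, hb⟩, Subtype.ext ?_⟩))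
      rw [LinearMap.sub_apply, LinearMap.smul_apply, Module.End.one_apply, Submodule.coe_sub, Submodule.coe_smul, hfX, hlamf]
      change X.map (Int.castRingHom ℤ_[3]) *ᵥ (fun c ↦ ((b c : ℤ) : ℤ_[3])) - (lam X : ℤ_[3]) • (fun c ↦ ((b c : ℤ) : ℤ_[3])) =
        fun c ↦ ((Matrix.mulVecLin (X - lam X • (1 : Matrix ι ι ℤ)) b c : ℤ) : ℤ_[3])
      rw [Matrix.mulVecLin_apply, hXb, intCast_vec_sub, intCast_vec_smul, map_intCast_mulVec']
  obtain ⟨hzB, hzN⟩ := hQmem z (hle hz)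
  exact ⟨hcastM z ((hB z).mp hzB), hzN⟩

/-- **Multiplicity one read over `ℤ₃`.** From the INTEGRAL (C3′) «for `x ∈ B`: `x − C x₀ ∈ 3B + Σ_{X ∈ G} (X − λ_X)B` for some `C ∈ ℤ[G]`»
to «for `x ∈ M`: `x − c x̂₀ ∈ 𝔪_{ℤ₃}·M + Σ_f (f − λ_f)·M` for some `c ∈ ℤ₃[s]`», where every generator `X` is the action of some `f ∈ s` with
`λ_f = λ_X` and every `C ∈ ℤ[G]` the action of some `c ∈ ℤ₃[s]` (`exists_mem_adjoin_acting`). [cite: Matsumura1987, Thm. 7.4 (i)] -/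
theorem exists_sub_mem_of_integral_cosocle (M : Submodule ℤ_[3] (ι → ℤ_[3])) (hM : ∀ v : ι → ℤ_[3], v ∈ M ↔ ∑ c, v c = 0)
    (B : Submodule ℤ (ι → ℤ)) (hB : ∀ v : ι → ℤ, v ∈ B ↔ ∑ c, v c = 0)
    (G : Set (Matrix ι ι ℤ)) (hGdeg : ∀ X ∈ G, ∀ v : ι → ℤ, ∑ c, v c = 0 → ∑ c, (X *ᵥ v) c = 0)
    (s : Set (Module.End ℤ_[3] M)) (lam : Matrix ι ι ℤ → ℤ) (lam' : Module.End ℤ_[3] M → ℤ_[3])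
    (hGs : ∀ X ∈ G, ∃ f ∈ s, lam' f = (lam X : ℤ_[3]) ∧
      ∀ m : M, ((f m : M) : ι → ℤ_[3]) = X.map (Int.castRingHom ℤ_[3]) *ᵥ (m : ι → ℤ_[3]))
    (hC : ∀ C ∈ Algebra.adjoin ℤ G, ∃ c ∈ Algebra.adjoin ℤ_[3] s,
      ∀ m : M, ((c m : M) : ι → ℤ_[3]) = C.map (Int.castRingHom ℤ_[3]) *ᵥ (m : ι → ℤ_[3]))
    (x₀ : ι → ℤ) (x₀M : M) (hx₀M : (x₀M : ι → ℤ_[3]) = fun c ↦ ((x₀ c : ℤ) : ℤ_[3]))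
    (hmult : ∀ x ∈ B, ∃ C ∈ Algebra.adjoin ℤ G, x - C *ᵥ x₀ ∈
      (3 : ℤ) • B ⊔ ⨆ X ∈ G, B.map (Matrix.mulVecLin (X - lam X • (1 : Matrix ι ι ℤ))))
    (x : M) :
    ∃ c ∈ Algebra.adjoin ℤ_[3] s, x - c x₀M ∈ maximalIdeal ℤ_[3] • (⊤ : Submodule ℤ_[3] M) ⊔
        ⨆ f ∈ s, LinearMap.range (f - lam' f • (1 : Module.End ℤ_[3] M)) := by
  classical
  by_cases hι : Nonempty ι
  swap
  · refine ⟨0, Subalgebra.zero_mem _, ?_⟩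
    have hx : x = 0 := Subtype.ext (funext fun c ↦ (hι ⟨c⟩).elim)
    rw [hx, LinearMap.zero_apply, sub_zero]
    exact Submodule.zero_mem _
  obtain ⟨c₀⟩ := hι
  have hspan := mem_span_intCast_degreeZero M hM c₀ x
  induction hspan using Submodule.span_induction with
  | mem m hm =>
      obtain ⟨b, hb, hmb⟩ := hm
      obtain ⟨C, hCG, hbC⟩ := hmult b ((hB b).mpr hb)
      obtain ⟨hzM, hzN⟩ := intCast_mem_cosocle M hM B hB G hGdeg s lam lam' hGs _ hbC
      obtain ⟨c, hc, hcC⟩ := hC C hCG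
      refine ⟨c, hc, ?_⟩
      have key : m - c x₀M = ⟨_, hzM⟩ := by
        apply Subtype.ext
        rw [Submodule.coe_sub, hcC, hmb, hx₀M]
        change _ = fun d ↦ (((b - C *ᵥ x₀) d : ℤ) : ℤ_[3])
        rw [intCast_vec_sub, map_intCast_mulVec']
      rw [key]
      exact hzN
  | zero =>
      refine ⟨0, Subalgebra.zero_mem _, ?_⟩
      rw [LinearMap.zero_apply, sub_zero]
      exact Submodule.zero_mem _
  | add m m' _ _ ih ih' =>
      obtain ⟨c, hc, h⟩ := ih
      obtain ⟨c', hc', h'⟩ := ih'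
      refine ⟨c + c', Subalgebra.add_mem _ hc hc', ?_⟩
      have : m + m' - (c + c') x₀M = (m - c x₀M) + (m' - c' x₀M) := by rw [LinearMap.add_apply]; abel
      rw [this]
      exact Submodule.add_mem _ h h'
  | smul a m _ ih =>
      obtain ⟨c, hc, h⟩ := ih
      refine ⟨a • c, Subalgebra.smul_mem _ hc a, ?_⟩
      have : a • m - (a • c) x₀M = a • (m - c x₀M) := by rw [LinearMap.smul_apply, smul_sub]
      rw [this]
      exact Submodule.smul_mem _ a h

end Lattices

end Summit.BirchSwinnertonDyer.BirchSwinnertonDyer.Theorems.LeafPartnerOrders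

end
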